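import Literature.Topology.FourManifolds.CellTriangulation
import HarnessLib

/-!
# Cells of an arrangement are subcomplexes of an adapted triangulation

A complement to `CellTriangulation.lean` (Munkres' cell triangulations adapted to finitely many
simplices and affine functionals, `exists_cellTriangulation`): the adaptedness it delivers —
every simplex `t` has a vertex `x` such that each functional `L₀ i` has, on `conv t`, sign `0`
or its sign at `x` — implies that every closed cell
`C = {L₀ j ≥ 0 (j ∈ J), L₀ j = 0 (j ∈ Z)}` (`cellSet`) of the arrangement is a **subcomplex**:
if a point of `conv t` with all barycentric weights positive lies in `C` then `conv t ⊆ C`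
(`convexHull_subset_cellSet_of_signs`; an affine functional with one-signed vertex values
vanishing at such a point vanishes identically, `affine_eq_zero_on_convexHull_of_signs`), and
every point of a closed simplex has positive weights on the subface it spans
(`exists_subface_pos_weights`).  Packaged for a simplex: `exists_triangulation_cells_subcomplex`
— an affinely independent `B` and finitely many cells `C_k` admit a finite complex `K` with
`K.space = conv B`, every face `conv B'` a union of simplices, and each `C_k ∩ conv B` the union
of the closed simplices of `K` inside `C_k`.

Use (engulfing, Rushing Lemma 1.6.3 / Thm. 4.2.1): the cone shadow of the singular set inside
one simplex `A = a * B` of the homotopy track is a union of cells of `conv B` (radial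
projections of `conv A ∩` affine subspaces); triangulating `B` with these cells and `∂B` as
subcomplexes makes the cone collapse `a * K ↘ a * K₀` of `StretchSequence.lean` available.
Everything is proved; theorems only.

## References

* J. R. Munkres, *Elementary differential topology*, Ann. of Math. Studies 54 (rev. 1966), §7,
  Lemmas 7.8, 7.10 and 10.2. [Munkres1966]
* T. B. Rushing, *Topological Embeddings*, Academic Press (1973), §1.6, Lemma 1.6.3.
  [Rushing1973]
-/

open Set Function
open scoped Topology

noncomputable section

namespace Literature.Topology.FourManifolds

open Literature.Analysis.Convexity

variable {E : Type*} [NormedAddCommGroup E] [NormedSpace ℝ E] [FiniteDimensional ℝ E]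

omit [FiniteDimensional ℝ E] in
/-- An affine functional whose values at the vertices of a simplex all have sign `0` or a fixed
sign, and which vanishes at a point with all barycentric weights positive, vanishes on the whole
closed simplex. [folklore] -/
theorem affine_eq_zero_on_convexHull_of_signs (L : E →ᵃ[ℝ] ℝ) {t : Finset E} {σ : SignType}
    (hsign : ∀ v ∈ t, SignType.sign (L v) = 0 ∨ SignType.sign (L v) = σ)
    {w : E → ℝ} (hw0 : ∀ v ∈ t, 0 < w v) (hw1 : ∑ v ∈ t, w v = 1)
    (hy : L (∑ v ∈ t, w v • v) = 0) : ∀ z ∈ convexHull ℝ (t : Set E), L z = 0 := by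
  -- all vertex values vanish
  have hval : L (∑ v ∈ t, w v • v) = ∑ v ∈ t, w v * L v := by
    have h := affineMap_apply_sum_smul (A := L) (g := fun v => L v) (t := t) (fun v _ => rfl) hw1
    simpa only [smul_eq_mul] using h
  rw [hval] at hy
  have hvert : ∀ v ∈ t, L v = 0 := by
    -- either all vertex values are `≥ 0` or all are `≤ 0`
    rcases le_or_gt 0 (σ : ℝ) with hσ | hσ
    · have hnn : ∀ v ∈ t, 0 ≤ L v := fun v hv => by
        rcases hsign v hv with h | h
        · exact (sign_eq_zero_iff.1 h).ge
        · by_contra hneg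
          push Not at hneg
          rw [sign_neg hneg] at h
          rw [← h, SignType.coe_neg_one] at hσ
          linarith
      have h0 := (Finset.sum_eq_zero_iff_of_nonneg fun v hv =>
        mul_nonneg (hw0 v hv).le (hnn v hv)).1 hy
      intro v hv
      rcases mul_eq_zero.1 (h0 v hv) with h | h
      · exact absurd h (hw0 v hv).ne'
      · exact h
    · have hnp : ∀ v ∈ t, L v ≤ 0 := fun v hv => by
        rcases hsign v hv with h | h
        · exact (sign_eq_zero_iff.1 h).le
        · by_contra hpos
          push Not at hpos
          rw [sign_pos hpos] at h
          rw [← h, SignType.coe_one] at hσ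
          linarith
      have hy' : ∑ v ∈ t, w v * (-L v) = 0 := by
        simp only [mul_neg, Finset.sum_neg_distrib, hy, neg_zero]
      have h0 := (Finset.sum_eq_zero_iff_of_nonneg fun v hv =>
        mul_nonneg (hw0 v hv).le (neg_nonneg.2 (hnp v hv))).1 hy'
      intro v hv
      rcases mul_eq_zero.1 (h0 v hv) with h | h
      · exact absurd h (hw0 v hv).ne'
      · exact neg_eq_zero.1 h
  -- hence `L` vanishes on every convex combination
  intro z hz
  obtain ⟨w', -, hw'1, rfl⟩ := Finset.mem_convexHull'.1 hz
  have h := affineMap_apply_sum_smul (A := L) (g := fun v => L v) (t := t) (fun v _ => rfl) hw'1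
  simp only [smul_eq_mul] at h
  rw [h]
  exact Finset.sum_eq_zero fun v hv => by rw [hvert v hv, mul_zero]

omit [FiniteDimensional ℝ E] in
/-- **A simplex whose signs are dominated by a vertex lies in every cell meeting its relative
interior.**  Let `t` be a simplex and `x ∈ t` a vertex such that, for every functional `L₀ i`,
the sign of `L₀ i` on `conv t` is `0` or its sign at `x` (the adaptedness delivered by
`exists_cellTriangulation`).  If a point of `conv t` with all barycentric weights positive lies
in the cell `{L₀ j ≥ 0 (j ∈ J), L₀ j = 0 (j ∈ Z)}`, then the whole closed simplex does.
[folklore] -/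
theorem convexHull_subset_cellSet_of_signs {ι₀ : Type*} (L₀ : ι₀ → E →ᵃ[ℝ] ℝ) {t : Finset E}
    {x : E} (hsign : ∀ i, ∀ y ∈ convexHull ℝ (t : Set E),
      SignType.sign (L₀ i y) = 0 ∨ SignType.sign (L₀ i y) = SignType.sign (L₀ i x))
    {w : E → ℝ} (hw0 : ∀ v ∈ t, 0 < w v) (hw1 : ∑ v ∈ t, w v = 1) {J Z : Set ι₀}
    (hy : (∑ v ∈ t, w v • v) ∈ cellSet L₀ J Z) : convexHull ℝ (t : Set E) ⊆ cellSet L₀ J Z := by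
  intro z hz
  have hvt : ∀ v ∈ t, v ∈ convexHull ℝ (t : Set E) := fun v hv => subset_convexHull ℝ _ hv
  refine ⟨fun j hj => ?_, fun j hj => ?_⟩
  · -- `L₀ j ≥ 0` at `y`; either `> 0`, and then the dominating sign is `+`, or `= 0` everywhere
    rcases (hy.1 j hj).lt_or_eq with hpos | h0
    · have hsx : SignType.sign (L₀ j x) = 1 := by
        rcases hsign j _ ((convex_convexHull ℝ _).sum_mem (fun v hv => (hw0 v hv).le) hw1 hvt)
          with h | h
        · rw [sign_eq_zero_iff] at h; exact absurd h hpos.ne'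
        · rw [← h, sign_pos hpos]
      rcases hsign j z hz with h | h
      · exact (sign_eq_zero_iff.1 h).ge
      · rw [hsx] at h
        by_contra hneg
        push Not at hneg
        rw [sign_neg hneg] at h
        exact absurd h (by decide)
    · exact (affine_eq_zero_on_convexHull_of_signs (L₀ j) (σ := SignType.sign (L₀ j x))
        (fun v hv => hsign j v (hvt v hv)) hw0 hw1 h0.symm z hz).ge
  · exact affine_eq_zero_on_convexHull_of_signs (L₀ j) (σ := SignType.sign (L₀ j x))
      (fun v hv => hsign j v (hvt v hv)) hw0 hw1 (hy.2 j hj) z hz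

omit [FiniteDimensional ℝ E] in
/-- Every point of a closed simplex is a combination with positive weights of the vertices of a
nonempty subface (the support of its barycentric weights). [folklore] -/
theorem exists_subface_pos_weights [DecidableEq E] {t : Finset E} {y : E}
    (hy : y ∈ convexHull ℝ (t : Set E)) :
    ∃ t' ⊆ t, t'.Nonempty ∧ ∃ w : E → ℝ, (∀ v ∈ t', 0 < w v) ∧ ∑ v ∈ t', w v = 1 ∧
      ∑ v ∈ t', w v • v = y := by
  obtain ⟨w, hw0, hw1, hwy⟩ := Finset.mem_convexHull'.1 hy
  refine ⟨t.filter fun v => 0 < w v, Finset.filter_subset _ t, ?_, w, fun v hv =>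
    (Finset.mem_filter.1 hv).2, ?_, ?_⟩
  · by_contra h
    rw [Finset.not_nonempty_iff_eq_empty, Finset.filter_eq_empty_iff] at h
    have : ∑ v ∈ t, w v = 0 :=
      Finset.sum_eq_zero fun v hv => le_antisymm (not_lt.1 (h hv)) (hw0 v hv)
    rw [hw1] at this
    exact one_ne_zero this
  · rw [Finset.sum_filter_of_ne fun v hv hne => ?_, hw1]
    exact lt_of_le_of_ne (hw0 v hv) (Ne.symm hne)
  · rw [Finset.sum_filter_of_ne fun v hv hne => ?_, hwy]
    exact lt_of_le_of_ne (hw0 v hv) fun h => hne (by rw [← h, zero_smul])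

/-- **Triangulating a simplex so that given cells are subcomplexes** (Munkres' adapted cell
triangulations, through `exists_cellTriangulation`).  Let `B` be an affinely independent finite
set and `C_k = {L₀ j ≥ 0 (j ∈ J_k), L₀ j = 0 (j ∈ Z_k)}` finitely many closed cells of an
arrangement of affine functionals.  There is a finite simplicial complex `K` with underlying
space `conv B`, in which every face `conv B'` (`∅ ≠ B' ⊆ B`) is a union of simplices, and such
that each `C_k ∩ conv B` is the union of the closed simplices of `K` contained in `C_k` (so that
`{t ∈ K | conv t ⊆ C_k}` is a subcomplex with underlying space `C_k ∩ conv B`).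
[cite: Munkres1966, Lemma 7.8 and 10.2] -/
theorem exists_triangulation_cells_subcomplex [DecidableEq E] {B : Finset E}
    (hB : AffineIndependent ℝ ((↑) : B → E)) {ι₀ : Type*} [Fintype ι₀] (L₀ : ι₀ → E →ᵃ[ℝ] ℝ)
    {κ : Type*} (J Z : κ → Set ι₀) :
    ∃ K : Geometry.SimplicialComplex ℝ E, K.faces.Finite ∧ K.space = convexHull ℝ (B : Set E) ∧
      (∀ B' ⊆ B, ∀ y ∈ convexHull ℝ (B' : Set E), ∃ t ∈ K.faces,
        y ∈ convexHull ℝ (t : Set E) ∧ convexHull ℝ (t : Set E) ⊆ convexHull ℝ (B' : Set E)) ∧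
      ∀ k, ∀ y ∈ convexHull ℝ (B : Set E), y ∈ cellSet L₀ (J k) (Z k) →
        ∃ t ∈ K.faces, y ∈ convexHull ℝ (t : Set E) ∧ convexHull ℝ (t : Set E) ⊆ cellSet L₀ (J k) (Z k) := by
  -- all nonempty subsets of `B` are affinely independent configurations
  set S : Finset (Finset E) := B.powerset.filter fun s => s.Nonempty with hS
  have hSind : ∀ s ∈ S, AffineIndependent ℝ ((↑) : s → E) := fun s hs => by
    have hsB : s ⊆ B := Finset.mem_powerset.1 (Finset.mem_filter.1 hs).1
    exact hB.mono (Finset.coe_subset.2 hsB)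
  rcases B.eq_empty_or_nonempty with rfl | hBne
  · -- degenerate: the empty configuration
    refine ⟨exists_cellTriangulation S hSind ∅ (Finset.empty_subset _) L₀ |>.choose, ?_⟩
    obtain ⟨hfin, hspace, -, -⟩ := (exists_cellTriangulation S hSind ∅ (Finset.empty_subset _) L₀).choose_spec
    refine ⟨hfin, by rw [hspace]; simp, fun B' hB' y hy => ?_, fun k y hy => ?_⟩
    · rw [Finset.subset_empty.1 hB'] at hy; simp at hy
    · simp at hy
  have hBS : B ∈ S := Finset.mem_filter.2 ⟨Finset.mem_powerset_self B, hBne⟩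
  obtain ⟨K, hfin, hspace, hcov, hvert⟩ :=
    exists_cellTriangulation S hSind {B} (Finset.singleton_subset_iff.2 hBS) L₀
  have hspace' : K.space = convexHull ℝ (B : Set E) := by rw [hspace]; simp
  refine ⟨K, hfin, hspace', fun B' hB' y hy => ?_, fun k y hyB hyC => ?_⟩
  · rcases B'.eq_empty_or_nonempty with rfl | hne
    · simp at hy
    · exact hcov B' (Finset.mem_filter.2 ⟨Finset.mem_powerset.2 hB', hne⟩) y hy
        ⟨B, Finset.mem_singleton_self B, convexHull_mono (Finset.coe_subset.2 hB') hy⟩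
  · -- a simplex through `y`, then the subface carrying `y` in its relative interior
    have hyK : y ∈ K.space := by rw [hspace']; exact hyB
    obtain ⟨t₀, ht₀, hyt₀⟩ := Geometry.SimplicialComplex.mem_space_iff.1 hyK
    obtain ⟨t, htt₀, htne, w, hw0, hw1, hwy⟩ := exists_subface_pos_weights hyt₀
    have ht : t ∈ K.faces := K.down_closed ht₀ htt₀ htne
    obtain ⟨x, -, -, -, hsign⟩ := hvert t ht
    refine ⟨t, ht, ?_, ?_⟩
    · rw [← hwy]
      exact (convex_convexHull ℝ _).sum_mem (fun v hv => (hw0 v hv).le) hw1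
        fun v hv => subset_convexHull ℝ _ hv
    · refine convexHull_subset_cellSet_of_signs L₀ hsign hw0 hw1 ?_
      rw [hwy]; exact hyC

end Literature.Topology.FourManifolds
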